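import Mathlib.Order.LiminfLimsup
import Mathlib.Analysis.SpecialFunctions.Pow.Real
import Mathlib.LinearAlgebra.Dimension.Finrank
import Mathlib.LinearAlgebra.FiniteDimensional.Defs
import Literature.Computability.AlgebraicComplexity.QuantumFunctionalsUpper
import Literature.Computability.AlgebraicComplexity.SchoenhageTau
import Literature.Computability.AlgebraicComplexity.WordTypes
import HarnessLib

/-!
# Isotypic multiplicities of tensor powers and the relative-multiplicity pressure functional

Topic `Literature/Computability/AlgebraicComplexity`; definition items `defn-isotypicMultiplicity`
and `defn-pressureFunctional` (route MatrixMultiplication/IsotypicSaturation, item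
`DarkPolytopePoint` = `stmt-MatrixMultiplication-4420`; card isotypic-saturation-dark-spectral-points).

## Sources

* P. Bürgisser, C. Ikenmeyer, *Geometric complexity theory and tensor rank*, STOC 2011 =
  arXiv:1011.1350 (`BurgisserIkenmeyer2011`; read pp. 3–4 and 13–14 of the arXiv version).
  §3.1, Def. 3.1: `S(w) = {λ | V_λ(G)^* occurs in 𝒪(\overline{Gw})}`, `G = GL(W₁)×GL(W₂)×GL(W₃)`,
  and the remark after (3.1): "a more refined approach would be to study the multiplicity of
  `V_λ(G)^*` in `𝒪(\overline{Gw})`, which can only decrease under degenerations." §10.1: "By a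
  highest weight vector in `M` of weight `λ` we understand a `U`-invariant weight vector in `M` of
  weight `λ`. These vectors (including the zero vector) form a linear subspace of `M` that we shall
  denote by `H_λ(M)`. It is known that `M` is irreducible iff `H_λ(M)` is one-dimensional."
  §10.2–10.3: Schur–Weyl duality `(W^*)^{⊗d} ≃ ⊕_λ [λ¹]⊗[λ²]⊗[λ³] ⊗ S_λ(W^*)`.
* M. Christandl, P. Vrana, J. Zuiddam, *Universal points in the asymptotic spectrum of tensors*,
  JAMS 36 (2023) = arXiv:1709.07851 (`ChristandlVranaZuiddam2023`), §3.1 and Def. 3.3 (the tree's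
  `QuantumFunctionalsUpper.lean`: `kroneckerPow`, `isotypicSumⱼ`, `partitionEntropy`).

## The isotypic multiplicity (`defn-isotypicMultiplicity`)

For a complex 3-tensor `t : ι → κ → μ → ℂ` on finite LINEARLY ORDERED index types (the order fixes
the Borel subgroups; the value does not depend on it), `n : ℕ` and a triple of partitions
`lam : Fin 3 → Nat.Partition n`, `isotypicMultiplicity t n lam` is the multiplicity of the irreducible
`G = GL(ℂ^ι)×GL(ℂ^κ)×GL(ℂ^μ)`-module of highest weight `(λ⁰, λ¹, λ²)` in the CYCLIC `G`-module
`⟨G · t^{⊗n}⟩ ⊆ (ℂ^ι ⊗ ℂ^κ ⊗ ℂ^μ)^{⊗n}` generated by the tensor power (in coordinates,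
`kroneckerPow t n`) — equivalently (duality `𝒪(\overline{Gw})_n ≅ ⟨G · w^{⊗n}⟩^*`) the multiplicity of
`V_λ(G)^*` in degree `n` of the coordinate ring of the orbit closure, the quantity of BI §3.1. It is
DEFINED, following BI §10.1, as the dimension of the space `H_λ` of highest weight vectors of weight
`λ` in that cyclic module: vectors annihilated by all raising operators `E^{(j)}_{pq}`, `p < q`, of the
three factors (`raiseOp₁/₂/₃`, the infinitesimal action of the strictly upper triangular matrices on
the `n` legs of factor `j`) and lying in the weight space of `λ` (`IsWeightVector`: supported on
index triples `(a, b, c)` whose letter counts are `λ⁰, λ¹, λ²` in the given orders). The cyclic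
module is the linear span of the images of `t^{⊗n}` under ALL triples of matrices
`(A, B, C) ↦ A^{⊗n} ⊗ B^{⊗n} ⊗ C^{⊗n}` (`matrixPowAct`); this is the span of the `G`-orbit, `G` being
Zariski dense in the matrix triples on which the action depends polynomially. By Schur–Weyl duality
(BI §10.2–10.3) the same number is the rank of `P_λ t^{⊗n}` across the cut
`S_λ(V₁)⊗S_λ(V₂)⊗S_λ(V₃) | [λ⁰]⊗[λ¹]⊗[λ²]`, and it vanishes iff the triple isotypic character sum
`isotypicSum₁ λ⁰ (isotypicSum₂ λ¹ (isotypicSum₃ λ² t^{⊗n}))` of `QuantumFunctionalsUpper.lean` vanishes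
(occurrence, CVZ Def. 3.3); these identifications are theorems NOT proved here.

## The pressure functional (`defn-pressureFunctional`; a NEW object of the card, not literature)

For `θ : Fin 3 → ℝ` (a point of the probability simplex) and `β : ℝ` (`β ≥ 0`, inverse temperature):
`pressureFunctional θ β t = limsup_{n → ∞} (∑_{λ ⊢ n occurring in t^{⊗n}}`
`(m_λ(t,n) / m_λ(σ_{R̲(t)}, n))^β · 2^{n (θ₀ H(λ̄⁰) + θ₁ H(λ̄¹) + θ₂ H(λ̄²))})^{1/n}` for `t ≠ 0`, and
`pressureFunctional θ β 0 = 0`; here `m_λ(σ_R, n) = genericIsotypicMultiplicity R n λ` is the value of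
`m_λ(·, n)` at a generic point of the secant variety `σ_R = {border rank ≤ R}` — DEFINED as the
maximum of `m_λ(u, n)` over `u` of border rank `≤ R` (`algBorderRank`) in the same format (multiplicity
is the rank of a matrix depending polynomially on `u`, hence lower semicontinuous, so its generic
value on the irreducible `σ_R` is its maximum) — and `R̲(t) = algBorderRank t`. Since `t ∈ σ_{R̲(t)}`,
every ratio lies in `[0, 1]`. At `β = 0` the summand is `2^{n·(weighted entropy)}` over the occurring
`λ` (the number of which is polynomial in `n`), the finite-`n` quantity behind CVZ's upper quantum
functional `F^θ = 2^{E^θ}` (Def. 3.3); the interface identities `P_{θ,0} = F^θ`, `P_{θ,β} ≥ F^θ`,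
`P_{θ,β}(⟨r⟩) = r` asked for by the card are theorems about this definition, NOT proved here.

Proved API (sanity): the raising operators and the matrix action kill `0`; multiplicities are bounded
by the ambient dimension (`isotypicMultiplicity_le_finrank`, so the generic maximum is over a bounded
set, `bddAbove_isotypicMultiplicity`), vanish for the zero tensor in positive degree
(`isotypicMultiplicity_zero`), and are attained below the generic value at border rank `≥ R̲(t)`
(`isotypicMultiplicity_le_generic`); `pressureFunctional θ β 0 = 0`.
-/

noncomputable section

open scoped BigOperators
open Filter Finset

namespace Literature.Computability.AlgebraicComplexity

universe u

section Multiplicity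

variable {ι κ μ : Type u} [Fintype ι] [Fintype κ] [Fintype μ] [DecidableEq ι] [DecidableEq κ]
  [DecidableEq μ] {n : ℕ}

/-- The ambient coordinate space of `n`-fold tensor powers, `(ℂ^ι ⊗ ℂ^κ ⊗ ℂ^μ)^{⊗n}` in the
coordinates of `kroneckerPow`. [cite: ChristandlVranaZuiddam2023, §3.1] -/
abbrev PowSpace (ι κ μ : Type u) (n : ℕ) : Type u := (Fin n → ι) → (Fin n → κ) → (Fin n → μ) → ℂ

/-- **The action of a triple of matrices on a tensor power**: `(A^{⊗n} ⊗ B^{⊗n} ⊗ C^{⊗n}) u`, in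
coordinates `(a, b, c) ↦ ∑_{a', b', c'} (∏ᵢ A (a i) (a' i)) (∏ᵢ B (b i) (b' i)) (∏ᵢ C (c i) (c' i)) u(a', b', c')`
— the diagonal action of `GL(W₁)×GL(W₂)×GL(W₃)` on `W^{⊗n}` (BI §3, §10.3), extended to all matrix
triples (on which it depends polynomially). [cite: BurgisserIkenmeyer2011, §3 and §10.3] -/
def matrixPowAct (A : Matrix ι ι ℂ) (B : Matrix κ κ ℂ) (C : Matrix μ μ ℂ) :
    PowSpace ι κ μ n →ₗ[ℂ] PowSpace ι κ μ n where
  toFun u := fun a b c => ∑ a' : Fin n → ι, ∑ b' : Fin n → κ, ∑ c' : Fin n → μ,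
    ((∏ i, A (a i) (a' i)) * (∏ i, B (b i) (b' i)) * ∏ i, C (c i) (c' i)) * u a' b' c'
  map_add' u v := by
    ext a b c
    simp only [Pi.add_apply, mul_add, sum_add_distrib]
  map_smul' r u := by
    ext a b c
    simp only [Pi.smul_apply, smul_eq_mul, RingHom.id_apply, mul_sum]
    refine sum_congr rfl fun a' _ => sum_congr rfl fun b' _ => sum_congr rfl fun c' _ => ?_
    ring

omit [DecidableEq ι] [DecidableEq κ] [DecidableEq μ] in
/-- The matrix action kills the zero tensor. [folklore] -/
@[simp] theorem matrixPowAct_zero (A : Matrix ι ι ℂ) (B : Matrix κ κ ℂ) (C : Matrix μ μ ℂ) :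
    matrixPowAct (n := n) A B C 0 = 0 :=
  map_zero _

/-- **The cyclic `G`-module generated by `t^{⊗n}`**, `⟨G · t^{⊗n}⟩ ⊆ W^{⊗n}`: the linear span of the
images of `kroneckerPow t n` under all matrix triples (the span of the `GL³`-orbit; its dual is
degree `n` of `𝒪(\overline{G t})`, BI §3.1). [cite: BurgisserIkenmeyer2011, §3.1 (with §10.4, res_{d,w})] -/
def cyclicPowModule (t : ι → κ → μ → ℂ) (n : ℕ) : Submodule ℂ (PowSpace ι κ μ n) :=
  Submodule.span ℂ (Set.range fun ABC : Matrix ι ι ℂ × Matrix κ κ ℂ × Matrix μ μ ℂ =>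
    matrixPowAct ABC.1 ABC.2.1 ABC.2.2 (kroneckerPow t n))

/-- **Raising operator on the first factor**: the infinitesimal action of the elementary matrix
`E_{pq}` (`e_q ↦ e_p`) of `gl(ℂ^ι)` on the `n` legs of factor `1`,
`(E¹_{pq} u)(a, b, c) = ∑_{i : a i = p} u(a[i ↦ q], b, c)`. Vectors killed by all `E_{pq}`, `p < q`,
are the `U`-invariants for the upper triangular unipotent group. [cite: BurgisserIkenmeyer2011, §10.1] -/
def raiseOp₁ (p q : ι) : PowSpace ι κ μ n →ₗ[ℂ] PowSpace ι κ μ n where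
  toFun u := fun a b c => ∑ i ∈ univ.filter (fun i => a i = p), u (Function.update a i q) b c
  map_add' u v := by ext a b c; simp [sum_add_distrib]
  map_smul' r u := by ext a b c; simp [mul_sum]

/-- Raising operator `E_{pq}` on the second factor. [cite: BurgisserIkenmeyer2011, §10.1] -/
def raiseOp₂ (p q : κ) : PowSpace ι κ μ n →ₗ[ℂ] PowSpace ι κ μ n where
  toFun u := fun a b c => ∑ i ∈ univ.filter (fun i => b i = p), u a (Function.update b i q) c
  map_add' u v := by ext a b c; simp [sum_add_distrib]
  map_smul' r u := by ext a b c; simp [mul_sum]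

/-- Raising operator `E_{pq}` on the third factor. [cite: BurgisserIkenmeyer2011, §10.1] -/
def raiseOp₃ (p q : μ) : PowSpace ι κ μ n →ₗ[ℂ] PowSpace ι κ μ n where
  toFun u := fun a b c => ∑ i ∈ univ.filter (fun i => c i = p), u a b (Function.update c i q)
  map_add' u v := by ext a b c; simp [sum_add_distrib]
  map_smul' r u := by ext a b c; simp [mul_sum]

/-- The `k`-th part of a partition in decreasing order, `0` beyond its length. [folklore] -/
def partOrZero (lam : Nat.Partition n) (k : ℕ) : ℕ :=
  ((lam.parts.sort (· ≥ ·)).getD k 0)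

variable [LinearOrder ι] [LinearOrder κ] [LinearOrder μ]

/-- The word `a` **has weight `λ`**: listing the alphabet increasingly, its `k`-th letter occurs
`λ_k` times (`λ` padded by zeros) — `e_a` is a weight vector of weight `λ` for the diagonal torus of
`GL(ℂ^α)`. [cite: BurgisserIkenmeyer2011, §10.1 (weight vectors)] -/
def HasWordWeight {α : Type u} [DecidableEq α] [Fintype α] [LinearOrder α] (lam : Nat.Partition n)
    (a : Fin n → α) : Prop :=
  ∀ p : α, letterCount a p = partOrZero lam ((univ.filter fun q => q < p).card)

/-- **The weight space of `(λ⁰, λ¹, λ²)`** in `W^{⊗n}`: tensors supported on index triples of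
weights `λ⁰, λ¹, λ²`. [cite: BurgisserIkenmeyer2011, §10.1 (weight vectors)] -/
def weightSpace (lam : Fin 3 → Nat.Partition n) : Submodule ℂ (PowSpace ι κ μ n) where
  carrier := {u | ∀ a b c, ¬ (HasWordWeight (lam 0) a ∧ HasWordWeight (lam 1) b ∧
    HasWordWeight (lam 2) c) → u a b c = 0}
  add_mem' {u v} hu hv := fun a b c h => by simp [hu a b c h, hv a b c h]
  zero_mem' := fun a b c _ => rfl
  smul_mem' r {u} hu := fun a b c h => by simp [hu a b c h]

/-- **The space `H_λ` of highest weight vectors of weight `λ`** in a submodule `C ⊆ W^{⊗n}`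
(BI §10.1: "a `U`-invariant weight vector in `M` of weight `λ` … form a linear subspace `H_λ(M)`"):
elements of `C` in the weight space of `λ` annihilated by every raising operator `E^{(j)}_{pq}`,
`p < q`, `j = 1, 2, 3`. [cite: BurgisserIkenmeyer2011, §10.1] -/
def highestWeightSpace (C : Submodule ℂ (PowSpace ι κ μ n)) (lam : Fin 3 → Nat.Partition n) :
    Submodule ℂ (PowSpace ι κ μ n) :=
  C ⊓ weightSpace lam ⊓
    (⨅ (p : ι) (q : ι) (_ : p < q), LinearMap.ker (raiseOp₁ (κ := κ) (μ := μ) (n := n) p q)) ⊓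
    (⨅ (p : κ) (q : κ) (_ : p < q), LinearMap.ker (raiseOp₂ (ι := ι) (μ := μ) (n := n) p q)) ⊓
    (⨅ (p : μ) (q : μ) (_ : p < q), LinearMap.ker (raiseOp₃ (ι := ι) (κ := κ) (n := n) p q))

/-- The highest weight space of a submodule lies in it. [folklore] -/
theorem highestWeightSpace_le (C : Submodule ℂ (PowSpace ι κ μ n)) (lam : Fin 3 → Nat.Partition n) :
    highestWeightSpace C lam ≤ C :=
  le_trans (le_trans (le_trans (le_trans inf_le_left inf_le_left) inf_le_left) inf_le_left) le_rfl

/-- **The isotypic multiplicity `m_λ(t, n)`** (`defn-isotypicMultiplicity`): the multiplicity of the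
irreducible `GL(ℂ^ι)×GL(ℂ^κ)×GL(ℂ^μ)`-module of highest weight `(λ⁰, λ¹, λ²)` in the cyclic module
generated by `t^{⊗n}` — equivalently of `V_λ(G)^*` in degree `n` of `𝒪(\overline{Gt})` ("the
multiplicity of `V_λ(G)^*` in `𝒪(\overline{Gw})`, which can only decrease under degenerations",
BI §3.1) — DEFINED as `dim H_λ(⟨G · t^{⊗n}⟩)`, the dimension of its highest weight vectors of
weight `λ` (BI §10.1). See the module docstring for the Schur–Weyl / rank descriptions (not proved
here). [cite: BurgisserIkenmeyer2011, §3.1 (Def. 3.1 and the remark after (3.1)) with §10.1] -/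
def isotypicMultiplicity (t : ι → κ → μ → ℂ) (n : ℕ) (lam : Fin 3 → Nat.Partition n) : ℕ :=
  Module.finrank ℂ ↥(highestWeightSpace (cyclicPowModule t n) lam)

/-- Multiplicities are bounded by the dimension of the ambient tensor power space. [folklore] -/
theorem isotypicMultiplicity_le_finrank (t : ι → κ → μ → ℂ) (n : ℕ)
    (lam : Fin 3 → Nat.Partition n) :
    isotypicMultiplicity t n lam ≤ Module.finrank ℂ (PowSpace ι κ μ n) :=
  Submodule.finrank_le _

/-- In positive degree the zero tensor has all multiplicities `0` (its tensor power, hence its cyclic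
module, vanishes). [folklore] -/
theorem isotypicMultiplicity_zero (hn : 0 < n) (lam : Fin 3 → Nat.Partition n) :
    isotypicMultiplicity (0 : ι → κ → μ → ℂ) n lam = 0 := by
  have hpow : kroneckerPow (0 : ι → κ → μ → ℂ) n = 0 := by
    ext a b c
    obtain ⟨i⟩ : Nonempty (Fin n) := ⟨⟨0, hn⟩⟩
    simp only [kroneckerPow_apply, Pi.zero_apply]
    exact prod_eq_zero (mem_univ i) rfl
  have hC : cyclicPowModule (0 : ι → κ → μ → ℂ) n = ⊥ := by
    rw [cyclicPowModule, Submodule.span_eq_bot]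
    rintro _ ⟨ABC, rfl⟩
    simp [hpow]
  have hH : highestWeightSpace (cyclicPowModule (0 : ι → κ → μ → ℂ) n) lam = ⊥ :=
    le_bot_iff.1 ((highestWeightSpace_le _ lam).trans hC.le)
  rw [isotypicMultiplicity, hH, finrank_bot]

/-- **The generic isotypic multiplicity on the secant variety `σ_R`** (border rank `≤ R`,
`algBorderRank`) in the format `ι × κ × μ`, degree `n`, type `λ`: the maximum of `m_λ(u, n)` over
`u ∈ σ_R` (the value at a generic point of the irreducible variety `σ_R`, multiplicity being lower
semicontinuous). [cite: BurgisserIkenmeyer2011, §3.1 (with Landsberg's σ_R; remark after (3.1))] -/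
def genericIsotypicMultiplicity (ι κ μ : Type u) [Fintype ι] [Fintype κ] [Fintype μ] [DecidableEq ι]
    [DecidableEq κ] [DecidableEq μ] [LinearOrder ι] [LinearOrder κ] [LinearOrder μ]
    (R n : ℕ) (lam : Fin 3 → Nat.Partition n) : ℕ :=
  ⨆ u : {u : ι → κ → μ → ℂ // algBorderRank u ≤ R}, isotypicMultiplicity u.1 n lam

/-- The family of multiplicities over `σ_R` is bounded above (by the ambient dimension). [folklore] -/
theorem bddAbove_isotypicMultiplicity (R n : ℕ) (lam : Fin 3 → Nat.Partition n) :
    BddAbove (Set.range fun u : {u : ι → κ → μ → ℂ // algBorderRank u ≤ R} =>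
      isotypicMultiplicity u.1 n lam) :=
  ⟨Module.finrank ℂ (PowSpace ι κ μ n), by
    rintro _ ⟨u, rfl⟩
    exact isotypicMultiplicity_le_finrank _ _ _⟩

/-- A tensor of border rank `≤ R` has multiplicities at most the generic ones on `σ_R`; in particular
`m_λ(t, n) ≤ m_λ(σ_{R̲(t)}, n)`, so the ratios in the pressure functional lie in `[0, 1]`. [folklore] -/
theorem isotypicMultiplicity_le_generic {t : ι → κ → μ → ℂ} {R : ℕ} (hR : algBorderRank t ≤ R)
    (n : ℕ) (lam : Fin 3 → Nat.Partition n) :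
    isotypicMultiplicity t n lam ≤ genericIsotypicMultiplicity ι κ μ R n lam :=
  le_ciSup (bddAbove_isotypicMultiplicity R n lam) ⟨t, hR⟩

end Multiplicity

/-! ### The pressure functional -/

section Pressure

variable {ι κ μ : Type u} [Fintype ι] [Fintype κ] [Fintype μ] [DecidableEq ι] [DecidableEq κ]
  [DecidableEq μ] [LinearOrder ι] [LinearOrder κ] [LinearOrder μ]

/-- **Occurrence of the type `λ` in `t^{⊗n}`** (CVZ Def. 3.3 with all three factors): the triple
isotypic character sum `P_{λ⁰}^{V₁} P_{λ¹}^{V₂} P_{λ²}^{V₃} t^{⊗n}` (up to a non-zero scalar) is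
non-zero. [cite: ChristandlVranaZuiddam2023, Def. 3.3 and §3.1] -/
def OccursIn (t : ι → κ → μ → ℂ) (n : ℕ) (lam : Fin 3 → Nat.Partition n) : Prop :=
  isotypicSum₁ (lam 0) (isotypicSum₂ (lam 1) (isotypicSum₃ (lam 2) (kroneckerPow t n))) ≠ 0

/-- The finite-`n` **partition function** of the pressure functional:
`Z_n(t) = ∑_{λ ⊢ n occurring in t^{⊗n}} (m_λ(t,n) / m_λ(σ_{R̲(t)}, n))^β · 2^{n (θ₀H(λ̄⁰) + θ₁H(λ̄¹) + θ₂H(λ̄²))}`.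
[folklore] -/
def pressurePartitionSum (θ : Fin 3 → ℝ) (β : ℝ) (t : ι → κ → μ → ℂ) (n : ℕ) : ℝ :=
  open Classical in
  ∑ lam : Fin 3 → Nat.Partition n, if OccursIn t n lam then
    ((isotypicMultiplicity t n lam : ℝ) /
        (genericIsotypicMultiplicity ι κ μ (algBorderRank t) n lam : ℝ)) ^ β *
      (2 : ℝ) ^ ((n : ℝ) * weightedPartitionEntropy θ lam)
    else 0

/-- **The relative-multiplicity pressure functional** `P_{θ,β}(t)` (`defn-pressureFunctional`; a new
object of the card isotypic-saturation-dark-spectral-points, NOT a literature notion):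
`limsup_{n → ∞} Z_n(t)^{1/n}` with `Z_n = pressurePartitionSum θ β t n`, for `t ≠ 0`, and
`P_{θ,β}(0) = 0`. At `β = 0` the summands are `2^{n·(θ-weighted entropy)}` over the `λ` occurring in
`t^{⊗n}`, the finite-`n` quantity behind CVZ's `F^θ = 2^{E^θ}` (Def. 3.3); the ratio
`m_λ(t,n)/m_λ(σ_{R̲(t)},n) ∈ [0,1]` weights occurrence by relative multiplicity ("pressure at inverse
temperature `β`"). The junk value of `Filter.limsup` for an unbounded sequence is not an issue for
`β ≥ 0` (then `0 ≤ Z_n ≤ #{λ ⊢ n}³ · 2^{n ∑ θⱼ log₂ dⱼ}`).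
[cite: ChristandlVranaZuiddam2023, Def. 3.3 (the case β = 0)] -/
def pressureFunctional (θ : Fin 3 → ℝ) (β : ℝ) (t : ι → κ → μ → ℂ) : ℝ :=
  open Classical in
  if t = 0 then 0
  else limsup (fun n : ℕ => pressurePartitionSum θ β t n ^ (1 / (n : ℝ))) atTop

/-- `P_{θ,β}(0) = 0` by definition. [folklore] -/
@[simp] theorem pressureFunctional_zero (θ : Fin 3 → ℝ) (β : ℝ) :
    pressureFunctional θ β (0 : ι → κ → μ → ℂ) = 0 := by
  simp [pressureFunctional]

/-- Unfolding of the pressure functional on a non-zero tensor. [folklore] -/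
theorem pressureFunctional_of_ne_zero (θ : Fin 3 → ℝ) (β : ℝ) {t : ι → κ → μ → ℂ} (ht : t ≠ 0) :
    pressureFunctional θ β t =
      limsup (fun n : ℕ => pressurePartitionSum θ β t n ^ (1 / (n : ℝ))) atTop := by
  simp [pressureFunctional, ht]

/-- The partition sums are non-negative (for every real `β`: each summand is a real power of a
non-negative ratio times a power of `2`). [folklore] -/
theorem pressurePartitionSum_nonneg (θ : Fin 3 → ℝ) (β : ℝ) (t : ι → κ → μ → ℂ) (n : ℕ) :
    0 ≤ pressurePartitionSum θ β t n := by
  classical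
  unfold pressurePartitionSum
  refine sum_nonneg fun lam _ => ?_
  split_ifs
  · exact mul_nonneg (Real.rpow_nonneg (div_nonneg (Nat.cast_nonneg _) (Nat.cast_nonneg _)) _)
      (Real.rpow_nonneg (by norm_num) _)
  · exact le_rfl

end Pressure

end Literature.Computability.AlgebraicComplexity
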